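import Summits.CriticalPhenomena.CardyFormulaZ2.Theorems.CardyBondTriangularBondTriangularCardyDiscreteDomainsOfParts
import Summits.CriticalPhenomena.CardyFormulaZ2.Theorems.CardyBondTriangularBondTriangularCardyUpperOfNoSneakPrep
import HarnessLib

/-!
# Route CardyBondTriangular · crux `BondTriangularCardy` (stmt-CriticalPhenomena-4664), line `birth`,
# stub `stub_sandwichUpper`: the upper half of the sandwich, reduced to the sneaking estimate

Helper of the stub `stub_sandwichUpper` (`Sig.stub_sandwichUpper = Sig.stub_clDuality →
Sig.stub_separatesOfIsPath → PartSig.sandwichUpper`, the upper half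
`P_{p_c}(crude crossing) ≤ f⁺¹_δ(z⁺_δ) + e(δ)` of Bollobás–Riordan's sandwich (19) p. 184 with
(40) p. 201 (Percolation, CUP 2006, Ch. 7) for critical bond percolation on `𝕋` in its
Chayes–Lei hexagon representation and the route's crude crossing event `embDomainCrossing` at
mesh `δ/√3`), second file (assembly; the fixed-mesh estimate and the definitions are in the
sibling `…UpperOfNoSneakPrep.lean`). It proves the whole stub EXCEPT one estimate, isolated as
the proposition `PartSig.noSneak`:

`sandwichUpper_of_noSneak : PartSig.clDuality → PartSig.noSneak → PartSig.sandwichUpper`,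

where `PartSig.clDuality` is, verbatim, the text of the lead's `Sig.stub_clDuality` (the
Chayes–Lei duality lemma, Lemma 5 for hexagon paths with half-edge connectivity; the blocking
theorem `Sig.stub_separatesOfIsPath` has LANDED and is used directly, `stub_separatesOfIsPath`),
`PartSig.sandwichUpper` is the landed text of the part (`…DiscreteDomainsOfParts.lean`), and
`PartSig.noSneak` says: for every corner radius `ρ > 0`, the `P_{p_c}`-probability of the event
`sneakEvent` — an open crude crossing of `Ω` from `A₀` to `A₂` COEXISTING with a blue Chayes–Lei
crossing of the shorter–fatter domain `G⁺_δ` from its stretch `1` to its stretch `3` all of whose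
hexagons are `ρ`-far from the four marked points — tends to `0` as `δ → 0⁺`. So
`theorem stub_sandwichUpper : Sig.stub_sandwichUpper := fun hA _ => sandwichUpper_of_noSneak hA h`
once `h : PartSig.noSneak` is available.

Proof of the reduction (configurationwise, `crude_real_le_clSepProb_add`; then in probability as
in the landed lower half `sandwichLower_of_armBound`). Let `ω` be a lattice configuration with a
crude open crossing and `σ = clOfBond ω`. By duality (`PartSig.clDuality`) the domain `G = G⁺_δ`
has a yellow crossing from stretch `0` to stretch `2` (a `𝕋`-walk of hexagons of `G`, none pure
blue, consecutive ones sharing a yellow (half-)edge, its end hexagons showing yellow towards the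
two stretches) or a blue crossing from stretch `1` to stretch `3`.
* A yellow crossing either meets the small ball `S` about the triangle `z = z⁺_δ` (the local bad
  event: a yellow arm from `S` to `A₀(G)`, which is far from `R.pt 3`), or, reversed and made
  simple (`Walk.bypass`), is a yellow simple path from `A₂(G)` to `A₀(G)` avoiding the three
  vertices of `z` and a path joining `z` to the marked site `v₃` inside `S` (Claim 21,
  `IsDiscreteApprox.site_conn`); by blocking (`stub_separatesOfIsPath`) it separates `z` from
  the stretch `1`, so `σ ∈ E¹(z)` for the 3-marked domain `G.dropLast` (its stretch `2` contains
  the stretch `2` of `G`) — `clSepEvent_one_of_yellowCrossing` of the sibling file.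
* A blue crossing with a hexagon within `ρ` of a marked point `R.pt j` is a blue corner arm from
  `B(R.pt j, ρ)` to `∁B(R.pt j, r₂)` (its far end lies on `A₁(G)` or `A₃(G)`, `t`-close to the arc
  of `R` not containing `R.pt j`: `IsShorterFatter.arc_one/arc_three`); otherwise `ω ∈ sneakEvent`.
Hence `P_{p_c}(crude) ≤ f¹(z) + P(local yellow arm) + Σⱼ P(blue corner arm) + P_{p_c}(sneakEvent)`
(`bond_real_preimage_clOfBond_le`, `clSepProb_ofBond_eq`), and the yellow and blue one-arm bounds,
`PartSig.noSneak` and the diagonal choice `exists_scale_tendsto` give `e(δ) → 0`.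

Why `PartSig.noSneak` is isolated rather than proved. Bollobás–Riordan's Claim 19 (p. 192, with
the robustness remark p. 195: a far crossing of `G⁺` from `A₂` to `A₄` "prevents a crossing of
`D₄` from `A₁` to `A₃`") is a cross-cut argument (tree: `not_mem_triCrossing_compl_of_latticeCrosscut`
for G02's event, whose open paths have their mesh EDGES in `closure Ω`). For the route's crude
event only the VERTICES of the open bond path lie in `Ω`: an open bond of length `δ` may leave
`closure Ω` across a sub-mesh fold of `∂Ω` (two points of `A₃` within `δ` of each other), and the
centre polygon of the blue crossing — which crosses only CLOSED bonds
(`clBlueGraph_clOfBond_adj_iff`), hence never the open path — may exit `Ω` inside such a fold,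
so Newman's theorem (which needs the competing connected set inside `closure Ω`) does not apply,
and the configurationwise statement "far blue crossing ⇒ no crude crossing" fails in this
generality: if the arc `A₃` of `R` oscillates at the lattice scale — an interleaved comb of width
`o(1)` whose exterior teeth contain the rows of hexagon centres and whose interior gaps contain the
rows of bond-lattice sites — then a 4-marked domain satisfying `IsShorterFatter` at every
`(t, ρ)`, `arcs_close` and `fill` can carry, next to a crude open crossing running through the
comb (its bonds jumping the teeth), a blue stretch-1→3 crossing far from the corners which ends,
showing blue towards a dent of the domain's boundary inside the comb, without meeting the open
path (worked out in the stub worker's report to the line lead). What survives is the probability-`o(1)` form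
`PartSig.noSneak`: the coexistence forces, near the (random) fold, two yellow arms and a blue arm
at distance `o(1)`, a boundary three-arm event whose expected number of occurrences is `o(1)` —
an estimate beyond the qualitative one-arm bounds taken as hypotheses by the stub (it needs the
half-plane two-arm exponent `1` plus an extra arm, uniformly over boundary locations). For
conformal rectangles without sub-mesh folds on `A₁ ∪ A₃` (e.g. convex `Ω`, where a bond with
both ends in `Ω` lies in `Ω`) the cross-cut argument is expected to prove `PartSig.noSneak` with
the event eventually empty.

References: B. Bollobás, O. Riordan, *Percolation*, CUP 2006, Ch. 7, Lemma 5 p. 169, (19)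
p. 184, Claims 19–21 pp. 192–193, remark p. 195, (40) p. 201, p. 203; L. Chayes, H. K. Lei,
Rev. Math. Phys. 19 (2007) §2.1.
-/

noncomputable section

namespace Summit.CriticalPhenomena.CardyFormulaZ2.Theorems.BondTriangularCardyLine

open Set Filter Topology Metric MeasureTheory
open Literature.Probability.Percolation Literature.Probability.RandomPlanarGeometry
open Literature.Probability.RandomPlanarGeometry.MarkedDomain
open Literature.Probability.LatticeModels

/-! ### The upper half of the sandwich for a family of shorter–fatter discrete approximations -/

/-- **(D2)+(D3), upper half, reduced to the sneaking estimate: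
`P_{p_c}(crude crossing) ≤ f⁺¹_δ(z⁺_δ) + e(δ)`, `e → 0`.** Assume the Chayes–Lei duality lemma
(`PartSig.clDuality`, the text of the registered stub `Sig.stub_clDuality`) and the sneaking
estimate `PartSig.noSneak`. Then `PartSig.sandwichUpper` holds: given the yellow and the blue
one-arm bounds for the Chayes–Lei representation of critical bond-`𝕋`, for every discrete
approximation `G⁺_δ` of the conformal rectangle `R` which is eventually shorter–fatter at every
`(t, ρ)` there are triangles `z⁺_δ` of `G⁺_δ` with centres in `Ω` tending to `R.pt 3` and
`e(δ) → 0` with `P_{p_c}(embDomainCrossing (√3 (triEmbed · - (1+ζ)/3)) Ω (δ/√3) A₀ A₂) ≤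
f⁺¹_δ(z⁺_δ) + e(δ)` eventually — Bollobás–Riordan's "`P_δ(D₄) ≤ P_δ(G_δ⁺) + o(1)`" ((19) p. 184,
Claims 19–20 p. 192) and "`P_δ(G_δ⁺) = f_δ(z_δ) + o(1)`" ((40) p. 201, p. 203) for bond-`𝕋`,
through `crude_real_le_clSepProb_add`, the local connection of Claim 21
(`IsDiscreteApprox.site_conn`) and the diagonal choice `exists_scale_tendsto`. (The blocking
theorem enters through the landed `stub_separatesOfIsPath`.) -/
theorem sandwichUpper_of_noSneak : PartSig.clDuality → PartSig.noSneak → PartSig.sandwichUpper := by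
  intro hA hNS harmY harmB R G hG hSF
  classical
  have hd' : R.pt 3 ∈ closure R.carrier := frontier_subset_closure (R.pt_mem_frontier 3)
  obtain ⟨zs, hzs, hzt⟩ := hG.exists_faces_tendsto hd'
  -- notation for the crude crossing probability and the separating probability
  set Pb : ℝ → ℝ := fun δ => (bondPercolation triGraph (criticalWeightI (Real.pi / 6))).real
      (embDomainCrossing (fun x : Site 2 ↦ (Real.sqrt 3 : ℂ) * (triEmbed x - (1 + triZeta) / 3))
        R.carrier (δ / Real.sqrt 3) (R.arc 0) (R.arc 2)) with hPb
  set f : ℝ → ℝ := fun δ => (G δ).dropLast.clSepProb ChayesLeiHexPercolation.triBondCritical 1 (zs δ) with hf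
  -- the arc `A₀` of `R` stays away from `d' = R.pt 3`
  have hn0 : R.pt 3 ∉ R.arc 0 := fun h =>
    (R.eq_pt_or_eq_pt_of_mem_arc (i := 0) (j := 3) (by decide) h (R.pt_mem_arc_self 3)).elim
      (fun e => absurd (R.pt_injective e) (by decide)) (fun e => absurd (R.pt_injective e) (by decide))
  set c₀ : ℝ := infDist (R.pt 3) (R.arc 0) with hc₀def
  have hc₀ : 0 < c₀ := ((R.isClosed_arc 0).notMem_iff_infDist_pos ⟨_, R.pt_mem_arc_self 0⟩).1 hn0
  have hfar0 : ∀ w ∈ R.arc 0, c₀ ≤ dist w (R.pt 3) := fun w hw => by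
    rw [dist_comm]; exact infDist_le_dist_of_mem hw
  set c : ℝ := c₀ / 2 with hcdef
  have hc : 0 < c := by positivity
  have hcarc : ∀ᶠ δ in 𝓝[>] (0 : ℝ), ∀ s ∈ (G δ).arc 0, c ≤ dist (triMeshPoint δ s) (R.pt 3) :=
    hG.eventually_le_dist_of_arc hc₀ hfar0
  -- `v₃ → d'`
  have hv3 := hG.tendsto_markSite 3
  -- the opposite arcs `A₁`, `A₃` are far apart: the corner arms have far ends
  obtain ⟨ε₁₃, hε₁₃, hεd⟩ := R.exists_pos_forall_lt_dist_arc_one_three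
  set r₂ : ℝ := ε₁₃ / 4 with hr₂def
  have hr₂ : 0 < r₂ := by positivity
  set t₀ : ℝ := ε₁₃ / 4 with ht₀def
  have ht₀ : 0 < t₀ := by positivity
  have hAB : ∀ a ∈ R.arc 1, ∀ b ∈ R.arc 3, 2 * r₂ + t₀ < dist a b := fun a ha b hb => by
    have := hεd a ha b hb
    rw [hr₂def, ht₀def]; linarith
  -- the core estimate: eventually `P(crude) ≤ f¹(z_δ) + ε`
  have key : ∀ ε > (0 : ℝ), ∀ᶠ δ in 𝓝[>] (0 : ℝ), Pb δ ≤ f δ + ε := by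
    intro ε hε
    obtain ⟨ρa, hρa, Ca, hCa, hYb⟩ := harmY (ε / 6) (by positivity)
    obtain ⟨ρb, hρb, Cb, hCb, hBb⟩ := harmB (ε / 6) (by positivity)
    -- corner radius and local radius
    set ρc : ℝ := min r₂ (ρb * r₂) with hρc
    have hρc0 : 0 < ρc := lt_min hr₂ (mul_pos hρb hr₂)
    have hρcb : ρc ≤ ρb * r₂ := min_le_right _ _
    have hSFev := hSF ρc hρc0 t₀ ht₀
    have hNSev : ∀ᶠ δ in 𝓝[>] (0 : ℝ),
        (bondPercolation triGraph (criticalWeightI (Real.pi / 6))).real (sneakEvent R (G δ) δ ρc) < ε / 6 :=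
      (tendsto_order.1 (hNS R G hG hSF ρc hρc0)).2 _ (by positivity)
    set γ : ℝ := ρa * (c / 2) with hγdef
    have hγ : 0 < γ := by positivity
    obtain ⟨η, hη, hconn⟩ := hG.site_conn (γ / 2) (by positivity)
    set θ : ℝ := min (γ / 1000) (min (η / 4) (c / 4)) with hθ
    have hθpos : 0 < θ := by positivity
    have hθγ : θ ≤ γ / 1000 := min_le_left _ _
    have hθη : θ ≤ η / 4 := (min_le_right _ _).trans (min_le_left _ _)
    have hθc : θ ≤ c / 4 := (min_le_right _ _).trans (min_le_right _ _)
    have hK : ∀ᶠ δ : ℝ in 𝓝[>] 0, dist ((δ : ℂ) * hexCenter (zs δ)) (R.pt 3) < θ :=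
      hzt.eventually (ball_mem_nhds _ hθpos)
    have hV : ∀ᶠ δ in 𝓝[>] (0 : ℝ), dist (triMeshPoint δ ((G δ).markSite 3)) (R.pt 3) < θ :=
      hv3.eventually (ball_mem_nhds _ hθpos)
    have hsmall : ∀ᶠ δ in 𝓝[>] (0 : ℝ), δ ∈ Ioo 0 (min θ (min (ρc / Cb) (γ / Ca))) :=
      Ioo_mem_nhdsGT (by positivity)
    filter_upwards [hzs, hcarc, hconn, hK, hV, hsmall, hSFev, hNSev] with δ hzs hcarc hconn hK hV hδ hSFδ hNSδ
    have hδpos : 0 < δ := hδ.1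
    have hδθ : δ < θ := hδ.2.trans_le (min_le_left _ _)
    have hCρ : Cb * δ ≤ ρc := by
      have h := hδ.2.trans_le ((min_le_right _ _).trans (min_le_left _ _))
      rw [lt_div_iff₀ hCb] at h; linarith
    have hCγ : Ca * δ ≤ γ := by
      have h := hδ.2.trans_le ((min_le_right _ _).trans (min_le_right _ _))
      rw [lt_div_iff₀ hCa] at h; linarith
    set K : ℂ := (δ : ℂ) * hexCenter (zs δ) with hKdef
    have h3K : dist (triMeshPoint δ ((G δ).markSite 3)) K < 2 * θ := by
      calc dist (triMeshPoint δ ((G δ).markSite 3)) K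
          ≤ dist (triMeshPoint δ ((G δ).markSite 3)) (R.pt 3) + dist (R.pt 3) K := dist_triangle _ _ _
        _ < θ + θ := add_lt_add hV (by rw [dist_comm]; exact hK)
        _ = 2 * θ := by ring
    -- the vertices of `z_δ` are within `γ` of its centre
    have hzK : ∀ y ∈ hexFaceVertices (zs δ), dist (triMeshPoint δ y) ((δ : ℂ) * hexCenter (zs δ)) < γ := by
      intro y hy
      have h1 := dist_triMeshPoint_hexCenter_le hy δ
      rw [abs_of_pos hδpos] at h1
      linarith
    -- a vertex of `z_δ` is joined to `v₃` inside the ball of radius `γ`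
    have hjoin : ∃ y ∈ hexFaceVertices (zs δ), PathIn triGraph
        (((G δ).verts : Set (Site 2)) ∩ {v | dist (triMeshPoint δ v) ((δ : ℂ) * hexCenter (zs δ)) < γ})
          y ((G δ).markSite 3) := by
      have hy : faceVertex (zs δ) 0 ∈ (G δ).verts := ((G δ).mem_faces).1 hzs.1 (faceVertex_mem _ _)
      have hyK : dist (triMeshPoint δ (faceVertex (zs δ) 0)) K ≤ δ := by
        have := dist_triMeshPoint_hexCenter_le (faceVertex_mem (zs δ) 0) δ
        rwa [abs_of_pos hδpos] at this
      have hdist : dist (triMeshPoint δ (faceVertex (zs δ) 0)) (triMeshPoint δ ((G δ).markSite 3)) < η := by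
        calc dist (triMeshPoint δ (faceVertex (zs δ) 0)) (triMeshPoint δ ((G δ).markSite 3))
            ≤ dist (triMeshPoint δ (faceVertex (zs δ) 0)) K + dist K (triMeshPoint δ ((G δ).markSite 3)) :=
              dist_triangle _ _ _
          _ < δ + 2 * θ := by rw [dist_comm K]; exact add_lt_add_of_le_of_lt hyK h3K
          _ < η := by linarith
      refine ⟨faceVertex (zs δ) 0, faceVertex_mem _ _, ?_⟩
      refine (hconn _ hy _ ((G δ).markSite_mem_verts 3) hdist).mono ?_
      rintro v ⟨hv, hvd⟩
      refine ⟨hv, ?_⟩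
      have hvd' : dist (triMeshPoint δ (faceVertex (zs δ) 0)) (triMeshPoint δ v) < γ / 2 := hvd
      show dist (triMeshPoint δ v) K < γ
      calc dist (triMeshPoint δ v) K
          ≤ dist (triMeshPoint δ v) (triMeshPoint δ (faceVertex (zs δ) 0)) +
            dist (triMeshPoint δ (faceVertex (zs δ) 0)) K := dist_triangle _ _ _
        _ < γ / 2 + δ := by rw [dist_comm]; exact add_lt_add_of_lt_of_le hvd' hyK
        _ ≤ γ := by linarith
    -- the sites of `A₀(G_δ)` are far from the centre of `z_δ`
    have harc : ∀ s ∈ (G δ).arc 0, c / 2 < dist (triMeshPoint δ s) ((δ : ℂ) * hexCenter (zs δ)) := by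
      intro s hs
      show c / 2 < dist (triMeshPoint δ s) K
      have h1 := hcarc s hs
      have := dist_triangle (triMeshPoint δ s) K (R.pt 3)
      linarith
    have hface : hexFaceVertices (zs δ) ⊆ (G δ).verts := ((G δ).mem_faces).1 hzs.1
    -- the estimate at mesh `δ`
    have hle := crude_real_le_clSepProb_add hA R hr₂ hAB (G δ) hSFδ hface hzK hjoin harc
    have hcorner : ∀ j : Fin 4, (clHexPercolation ChayesLeiHexPercolation.triBondCritical).real
        {σ | ∃ x y : Site 2, (clBlueGraph σ).Reachable x y ∧ ‖triMeshPoint δ x - R.pt j‖ < ρc ∧ r₂ < ‖triMeshPoint δ y - R.pt j‖} ≤ ε / 6 :=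
      fun j => hBb δ (R.pt j) ρc r₂ hδpos hCρ hρcb
    have hloc : (clHexPercolation ChayesLeiHexPercolation.triBondCritical).real
        {σ | ∃ x y : Site 2, (clYellowGraph σ).Reachable x y ∧
          ‖triMeshPoint δ x - (δ : ℂ) * hexCenter (zs δ)‖ < γ ∧ c / 2 < ‖triMeshPoint δ y - (δ : ℂ) * hexCenter (zs δ)‖} ≤ ε / 6 :=
      hYb δ _ γ (c / 2) hδpos hCγ le_rfl
    have hsum : ∑ j : Fin 4, (clHexPercolation ChayesLeiHexPercolation.triBondCritical).real
        {σ | ∃ x y : Site 2, (clBlueGraph σ).Reachable x y ∧ ‖triMeshPoint δ x - R.pt j‖ < ρc ∧ r₂ < ‖triMeshPoint δ y - R.pt j‖} ≤ 4 * (ε / 6) := by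
      calc ∑ j : Fin 4, (clHexPercolation ChayesLeiHexPercolation.triBondCritical).real
            {σ | ∃ x y : Site 2, (clBlueGraph σ).Reachable x y ∧ ‖triMeshPoint δ x - R.pt j‖ < ρc ∧ r₂ < ‖triMeshPoint δ y - R.pt j‖}
          ≤ ∑ _j : Fin 4, ε / 6 := Finset.sum_le_sum fun j _ => hcorner j
        _ = 4 * (ε / 6) := by simp
    have hPbδ : Pb δ = (bondPercolation triGraph (criticalWeightI (Real.pi / 6))).real
        (embDomainCrossing (fun x : Site 2 ↦ (Real.sqrt 3 : ℂ) * (triEmbed x - (1 + triZeta) / 3))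
          R.carrier (δ / Real.sqrt 3) (R.arc 0) (R.arc 2)) := rfl
    have hfδ : f δ = (G δ).dropLast.clSepProb ChayesLeiHexPercolation.triBondCritical 1 (zs δ) := rfl
    rw [hPbδ, hfδ]
    linarith [hle, hsum, hloc, hNSδ.le]
  -- the diagonal choice of `e`
  have hPall : ∀ ε > (0 : ℝ), ∃ δ₁ > (0 : ℝ), ∀ δ, 0 < δ → δ < δ₁ → Pb δ ≤ f δ + ε := by
    intro ε hε
    obtain ⟨δ₁, hδ₁, h⟩ := exists_forall_Ioo_of_eventually (key ε hε)
    exact ⟨δ₁, hδ₁, fun δ hδ hδ₁' => h δ ⟨hδ, hδ₁'⟩⟩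
  obtain ⟨e, he, -, heP⟩ := exists_scale_tendsto hPall
  exact ⟨zs, e, hzs, hzt, he, heP.mono fun δ hδ => hδ⟩

end Summit.CriticalPhenomena.CardyFormulaZ2.Theorems.BondTriangularCardyLine

end
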